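import Literature.MathematicalPhysics.QuantumFieldTheory.Balaban1983to89.Node00.Record13ResidualsR

/-!
# DAG node N11 — THE PIN-COMPLETION LEMMA FOR A RESIDUAL 𝐓-WEIGHT DATUM: any family of prescribed values `a_j(ω) ∈ [0, 1]` on `Y = T`, local at scale `j`,
# extends to a residual `Z : TkResidualW` obeying 12a's law `ζ0 ≥ 0`, 12b's locality law and print's partition of unity `Σᶠ_Y ζ0_j(Y)(ω) = 1` at EVERY
# generation, with `ζ0_j(T) = a_j`, `quad ≡ 0` — the shape in which the generation-wise pins of the no-expansion diagonal (p522000 · p523822 · p527502 ·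
# `…AllLargeCoP`) are to be realised by a witness's residual (K0a∕K0b's pen; after director-ym №169's H1 in the run-indexed slot `Zr p`)

Cell `pub-ymgap`, YM-PLAN Track A (HUMAN RULING D-0062), seat `pub-ymgap-dag-n11-d` (g7; R134 fan-out seat N11 [B14], strategy s2), route `BalabanUVNodes`
rev 21∕22, item K1⁵ `StabilityBAtRecordR13SepCoP` = stmt-QuantumFields-20294 (helper, count-neutral).  [III] = [Balaban1988Convergent].  Over K0b's
`Node00/Record12Residuals` (`TkResidualW`, `Laws`, `LocalLaws`, the finite sum over regions) and K0a's `Node00/Record13ResidualsR` (FILE 17 p529638: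
`seqAllLargeOfRecord`, the all-large-field index; `ZrOfRecord₁₃`, the instance of record of §1's generic completion at the diagonal pins) only.

WHY THIS FILE.  This seat's positive results pin the residual factor ON `Y = T` at each generation `j` to a prescribed function `a_j` (def-T's level-`j`
resummed step weight on the scale-`j` averaging graph, values in `[0,1]`, reading the scale-`j` variables).  A tuple must ALSO carry 12a's law, 12b's locality
law and — for K1's guard `ZtUnity` ∕ the future `ZrUnity` — print's partition of unity over ALL regions `Y`.  The generation-0 instance of the completion
`ζ0_j(T) := a_j`, `ζ0_j(∅) := 1 − a_j`, `ζ0_j(Y) := 0` otherwise was built inside p523822's cure certificate; here it is stated ONCE for all generations and an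
arbitrary prescribed family, as an existence lemma (no `def`: the datum is exhibited inside the proof); node00-def-K0a's `ZrOfRecord₁₃` (FILE 17, landed while this
file was in its window) is the DEFINITION of record of this completion at the diagonal pins `a_j = stepWeightPinOfRecord₁₃` (generations `j < K`).

WHAT THIS FILE PROVES (0 `sorry`, 0 `def`, standard axioms; `N`-generic, any torus `K`).  ★ `exists_residual_pinned_on_univ`: for every family
`a : ℕ → MultiCfg → ℝ` with `0 ≤ a j ω ≤ 1` and `ω j = ω' j → a j ω = a j ω'`, there is `Z : TkResidualW F N (FluctV N) K` with `Z.Laws`, `Z.LocalLaws`,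
`∀ j ω, Σᶠ_Y Z.ζ0 j Y ω = 1`, `∀ j ω, Z.ζ0 j Set.univ ω = a j ω` and `∀ j Y ω, Z.quad j Y ω = 0`; `exists_residual_pinned_on_univ_of_gauge` (the diagonal shape).
§2 `seq_eq_of_allLarge`, `seq_eq_seqAllLargeOfRecord`, `seq_one_eq_seqAllLargeOfRecord` (a sequence of record whose `Ω_j` vanish on the window IS K0a's all-large-field
index `seqAllLargeOfRecord` — the glue between this seat's `hall`∕`Ω₁ = ∅` hypotheses and FILE 17's pin faces).

HONEST FRAMING.  Elementary bookkeeping (a two-point partition of unity on the finite type of regions); count-neutral; it does NOT say the completed residual is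
print's `ζ_j(R,S)` off `Y = T` (on `Y ≠ T` print's resummation (3.16)–(3.20) is what a faithful constructor must use — the completion here is the minimal
12b-legal one, enough for the no-expansion diagonal where only `Y = T` is read).  Nothing of Bałaban's asserted; N11 NOT discharged; counts unmoved (typed 28∕28 ·
discharged 5∕28).  One finite four-torus programme at fixed `ε = L^{−K}`; NOT ℝ⁴, NOT OS, NOT a mass gap, NOT Clay.  Sources: [III] (3.16)–(3.20) pp. 268–269,
(2.21) p. 258, (1.11) p. 248.
-/

noncomputable section

open scoped BigOperators

namespace Summit.QuantumFields.YangMills.Theorems.BalabanUVNodesN11ResidualPinCompletion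

open Literature.MathematicalPhysics.QuantumFieldTheory.Balaban1983to89 T4Continuum Node00 Node00.Tk

variable (F : T4Family) (N : ℕ)

/-- **★ THE PIN-COMPLETION LEMMA.**  Any prescribed family `a_j : MultiCfg → [0,1]` that is local at scale `j` is the `Y = T` value of SOME residual 𝐓-weight
datum `Z` on the torus `T_{L^{−K}}` obeying 12a's law `ζ0 ≥ 0`, 12b's locality law, print's partition of unity `Σᶠ_Y ζ0_j(Y) = 1` at every generation and
configuration, and `quad ≡ 0` (the Gaussian placeholders of the no-expansion storeys): `ζ0_j(T) := a_j`, `ζ0_j(∅) := 1 − a_j`, `ζ0_j(Y) := 0` for `∅ ≠ Y ≠ T`.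
[cite: Balaban1988Convergent, (3.16)–(3.20) pp.268–269, (2.21) p.258] -/
theorem exists_residual_pinned_on_univ (K : ℕ) (a : ℕ → MultiCfg (F.P K) (SU N) (FluctV N) → ℝ)
    (ha0 : ∀ j ω, 0 ≤ a j ω) (ha1 : ∀ j ω, a j ω ≤ 1)
    (haloc : ∀ (j : ℕ) (ω ω' : MultiCfg (F.P K) (SU N) (FluctV N)), ω j = ω' j → a j ω = a j ω') :
    ∃ Z : TkResidualW F N (FluctV N) K,
      Z.Laws ∧ Z.LocalLaws ∧
      (∀ (j : ℕ) (ω : MultiCfg (F.P K) (SU N) (FluctV N)), (∑ᶠ Y : Set (Site (F.P K) 0), Z.ζ0 j Y ω) = 1) ∧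
      (∀ (j : ℕ) (ω : MultiCfg (F.P K) (SU N) (FluctV N)), Z.ζ0 j Set.univ ω = a j ω) ∧
      (∀ (j : ℕ) (Y : Set (Site (F.P K) 0)) (ω : MultiCfg (F.P K) (SU N) (FluctV N)), Z.quad j Y ω = 0) := by
  classical
  have hne : (Set.univ : Set (Site (F.P K) 0)) ≠ ∅ :=
    Set.nonempty_iff_ne_empty.mp ⟨(fun _ => 0 : Fin (F.P K).d → ZMod ((F.P K).sitesPerDir 0)), Set.mem_univ _⟩
  let ζf : ℕ → Set (Site (F.P K) 0) → MultiCfg (F.P K) (SU N) (FluctV N) → ℝ := fun j Y ω =>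
    if Y = Set.univ then a j ω else if Y = ∅ then 1 - a j ω else 0
  have hζf : ∀ j Y ω, ζf j Y ω = (if Y = Set.univ then a j ω else if Y = ∅ then 1 - a j ω else 0) := fun _ _ _ => rfl
  refine ⟨⟨ζf, fun _ _ _ => 0⟩, ⟨fun j Y ω => ?_⟩, ⟨fun j Y ω ω' h => ?_⟩, fun j ω => ?_, fun j ω => ?_, fun _ _ _ => rfl⟩
  · -- 12a's law
    show 0 ≤ ζf j Y ω
    rw [hζf]
    split_ifs
    exacts [ha0 j ω, sub_nonneg.mpr (ha1 j ω), le_rfl]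
  · -- 12b's locality law (arity-robust under both rows of `zeta0_local` — W2 of the FLAG №1 R2b cure, dag-n11-d 2026-08-29: `ζf` is one-scale)
    have key : ζf j Y ω = ζf j Y ω' := by rw [hζf, hζf, haloc j ω ω' h]
    tauto
  · -- partition of unity
    show (∑ᶠ Y : Set (Site (F.P K) 0), ζf j Y ω) = 1
    have hfun : (fun Y : Set (Site (F.P K) 0) => ζf j Y ω) = fun Y => if Y = Set.univ then a j ω else if Y = ∅ then 1 - a j ω else 0 :=
      funext fun Y => hζf j Y ω
    haveI : Fintype (Set (Site (F.P K) 0)) := Fintype.ofFinite _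
    rw [hfun, finsum_eq_sum_of_fintype,
      Finset.sum_eq_add_of_mem (Set.univ : Set (Site (F.P K) 0)) ∅ (Finset.mem_univ _) (Finset.mem_univ _) hne]
    · rw [if_pos rfl, if_neg (Ne.symm hne), if_pos rfl]
      ring
    · intro c _ hc
      rw [if_neg hc.1, if_neg hc.2]
  · -- the pin on `T`
    show ζf j Set.univ ω = a j ω
    rw [hζf, if_pos rfl]

/-- **COROLLARY FOR THE DIAGONAL PINS**: a family read on the scale-`j` GAUGE variables only — `a_j(ω) := b_j((ω j).1)` with `0 ≤ b_j ≤ 1` — is local at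
scale `j`, so the lemma applies: this is the shape `b_j(V_j) := w_j(s′)(V_j, V̄_j)` of the generation-wise pins (the completed residual then reads the RUN
through `b`, which is why it lives in a run-indexed slot — director-ym №169 H1). [cite: Balaban1988Convergent, (1.11) p.248, (3.16) p.268] -/
theorem exists_residual_pinned_on_univ_of_gauge (K : ℕ) (b : (j : ℕ) → GaugeField (F.P K) j (SU N) → ℝ)
    (hb0 : ∀ j V, 0 ≤ b j V) (hb1 : ∀ j V, b j V ≤ 1) :
    ∃ Z : TkResidualW F N (FluctV N) K,
      Z.Laws ∧ Z.LocalLaws ∧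
      (∀ (j : ℕ) (ω : MultiCfg (F.P K) (SU N) (FluctV N)), (∑ᶠ Y : Set (Site (F.P K) 0), Z.ζ0 j Y ω) = 1) ∧
      (∀ (j : ℕ) (ω : MultiCfg (F.P K) (SU N) (FluctV N)), Z.ζ0 j Set.univ ω = b j (ω j).1) ∧
      (∀ (j : ℕ) (Y : Set (Site (F.P K) 0)) (ω : MultiCfg (F.P K) (SU N) (FluctV N)), Z.quad j Y ω = 0) :=
  exists_residual_pinned_on_univ F N K (fun j ω => b j (ω j).1) (fun j ω => hb0 j _) (fun j ω => hb1 j _)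
    (fun j ω ω' h => by simp only [h])


/-! ## §2. The sequences the diagonal pins read: the all-large-field sequence is UNIQUE at every length (existence = K0a's `seqAllLargeOfRecord`, FILE 17) -/

section AllLarge

variable {F N} [NeZero N]
variable (ν : Stage7Numerics) (M : ℕ) (g : ℕ → ℝ) (K n : ℕ)

/-- **THE ALL-LARGE-FIELD SEQUENCE IS UNIQUE**: two sequences of record of the same length whose `Ω_j` are empty on the window coincide (`Λ_j ⊆ Ω_j`; both vanish
off the window) — so «the all-large-field sequence of length `k+1`» the generation-`k` pin reads is ONE object. [cite: Balaban1988Convergent, (2.1) p.254 (bookkeeping)] -/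
theorem seq_eq_of_allLarge (s s' : SeqOfRecord F ν M g K n) (hs : ∀ j, 1 ≤ j → j ≤ n → s.Ω j = ∅) (hs' : ∀ j, 1 ≤ j → j ≤ n → s'.Ω j = ∅) : s = s' := by
  have hΩ : ∀ (t : SeqOfRecord F ν M g K n), (∀ j, 1 ≤ j → j ≤ n → t.Ω j = ∅) → ∀ j, t.Ω j = ∅ := fun t ht j => by
    by_cases hj : 1 ≤ j ∧ j ≤ n
    · exact ht j hj.1 hj.2
    · exact t.Ω_off j hj
  have hΛ : ∀ (t : SeqOfRecord F ν M g K n), (∀ j, 1 ≤ j → j ≤ n → t.Ω j = ∅) → ∀ j, t.Λ j = ∅ := fun t ht j => by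
    by_cases hj : 1 ≤ j ∧ j ≤ n
    · exact Set.subset_empty_iff.mp ((t.chain.Λ_subset j hj.1 hj.2).trans (ht j hj.1 hj.2).subset)
    · exact t.Λ_off j hj
  exact B14.Eq218Concrete.Seq.ext' (funext fun j => by rw [hΩ s hs j, hΩ s' hs' j]) (funext fun j => by rw [hΛ s hs j, hΛ s' hs' j])

/-- **… HENCE EQUALS K0a's INDEX OF RECORD** `seqAllLargeOfRecord` (FILE 17): every sequence of record whose `Ω_j` vanish on the window `1 ≤ j ≤ n` — the
hypothesis shape `hall` of this seat's `hasSect2FormAtZ_clause_succ_CoP_of_allLarge_pin` (p528220) — IS the all-large-field index, so K0a's pin faces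
`ZrOfRecord₁₃_ζ0_univ_pairCfgAt` ∕ `_zero_univ_pairCfg` (stated at `seqAllLargeOfRecord … (j+1)`) discharge that theorem's `hZ` at any such `s`.
[cite: Balaban1988Convergent, (2.1) p.254, (2.18) p.257 (bookkeeping)] -/
theorem seq_eq_seqAllLargeOfRecord (s : SeqOfRecord F ν M g K n) (hs : ∀ j, 1 ≤ j → j ≤ n → s.Ω j = ∅) : s = seqAllLargeOfRecord F ν M g K n :=
  seq_eq_of_allLarge ν M g K n s _ hs (fun j _ _ => seqAllLargeOfRecord_Ω F ν M g K n j)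

/-- The length-`1` case in the shape the level-one theorems carry (`Ω₁(s) = ∅`): `s` is the all-large-field index of length `1`.
[cite: Balaban1988Convergent, (2.21) p.258 (bookkeeping)] -/
theorem seq_one_eq_seqAllLargeOfRecord (s : SeqOfRecord F ν M g K 1) (hΩ : s.Ω 1 = ∅) : s = seqAllLargeOfRecord F ν M g K 1 :=
  seq_eq_seqAllLargeOfRecord ν M g K 1 s (fun j h1 h2 => by obtain rfl : j = 1 := le_antisymm h2 h1; exact hΩ)

end AllLarge

end Summit.QuantumFields.YangMills.Theorems.BalabanUVNodesN11ResidualPinCompletion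

end
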